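import Literature.AnabelianGeometry.SemiGraphs.MetabelianLeafStarEscapeIsolated
import HarnessLib

/-!
# The edge certificate of an ARBITRARY compact-generating element of `π₁^temp(𝒢⋆(p))` via linear characters
# («EXOTIC-ISOLATION@STAR», file F2)

Mochizuki, *Semi-graphs of anabelioids*, Publ. RIMS **42** (2006), §3, Prop. 3.6 (ii) p. 38, Remark 2.2.1 p. 24,
Theorem 3.7 (iii)/(iv) pp. 40–41 [cite: MochizukiSemiAnbd2006, Thm 3.7(iv) p.41].

PROOF-ONLY file (abc-iut cell, layer L3, row «EXOTIC-ISOLATION@STAR», seat abc-iut-L3-t8 gen 9; no definition,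
no named fact).  Canonical chart of the rayless star `𝒢⋆(p) = metabelianLeafStar p`; `Φ_{(c₁,c₂)}^{(e)}` the
torsor character of the linear system `(e; c₁, c₂)` of gen 8's `exists_linCharacter` (value `c₁ u + c₂ v` on
`ψ_Q(g)`, `ab(g) = (u, v)`, at every centre sequence `Q`; `(c₁ + c₂ pᵐ)·log` at the leaf `m`).  For an element
`d` of `π₁^temp(𝒢⋆(p))` (typically generating a compact ANCHOR-FREE procyclic subgroup) and the level trees
`𝒢_{∞,M}` of the canonical tower:

* `exists_linCharacter₂` — gen 8's character with its values on the LEAF decomposition groups also exported;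
* `proj_eq_one_of_aCharacter_eq_one` / **`exists_aCharacter_ne_one_of_fixes_edges`** — if `d ≠ 1` fixes some
  tree edge at every level from some level on, then some `a`-character `Φ_{(1,0)}^{(e₀)}` SEES `d` (value `≠ 1`):
  otherwise the exponent `k` of `d` at a fixed edge is divisible by every `p^e`, and `gal_P₀_pow` kills `ρ_j(d)`;
* **`forall_edgeMap_ne_of_twistCharacter_ne_one`** — GOOD base edges: if the twisted character
  `Φ_{(pⁿ,−1)}^{(e)}` sees `d`, then from its level `j₁` on `d` fixes NO edge of `𝒢_{∞,M}` over `n` (gen 6's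
  `edgeMap_edgeOf_ne_of_ne_one`);
* **`treeProj_edgeMap_eq_of_twistCharacter_eq_one`** — BAD base edge: if `Φ_{(1,0)}^{(e₀)}(d) ≠ 1` but
  `Φ_{(pⁿ,−1)}^{(n+e₀+1)}(d) = 1`, then from a level on EVERY `d`-fixed edge lies over `n` («pure type `n`»;
  `p`-adic arithmetic `dvd_of_dvd_sub_pow_mul`).

Consumers: F3 `MetabelianLeafStarPureTypeAnchored.lean` (pure type ⇒ anchored), F4
`MetabelianLeafStarExoticIsolation.lean`.  Honest framing: OUR typed tempered fundamental group of OUR countable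
carrier `𝒢⋆(p)`; print's Thm 3.7 (iv) at finite `𝔾` untouched; nothing here bears on [IUTchIII] Cor. 3.12; no
side taken; typed ≠ proved.
-/

noncomputable section

open CategoryTheory Topology Multiplicative Filter

namespace Literature.AnabelianGeometry.SemiGraphs

open IwahoriWitness

namespace ProfiniteSemiGraph

variable {p : ℕ} [hp : Fact p.Prime] {h36 : (metabelianLeafStar p).Prop36Hypotheses}
  (P₀ : ((metabelianLeafStar p).galoisLevelData h36).PointSeq h36.isCountable (leafStarCentre p))

/-! ### The linear characters, with their values on the leaf decomposition groups -/

/-- **The torsor character of the linear system `(e; c₁, c₂)`, centre AND leaf values exported**: a homomorphism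
on `π₁^temp(𝒢⋆(p))` restricting to `g ↦ c₁ u + c₂ v` (`ab(g) = (u,v)`) along every decomposition homomorphism
at the centre, to `(c₁ + c₂ pᵐ)·log` along every decomposition homomorphism at the leaf `m`, and killing
`ker ρ_j` for `j ≥ j₁` (gen 6's `exists_character_D`). [cite: MochizukiSemiAnbd2006, Prop 3.6(ii) p.38] -/
theorem exists_linCharacter₂ (h36 : (metabelianLeafStar p).Prop36Hypotheses) (e : ℕ) (c₁ c₂ : ZMod (p ^ e)) :
    ∃ (Φ : ((metabelianLeafStar p).galoisLevelData h36).temperedPi h36.isCountable →* Multiplicative (ZMod (p ^ e)))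
      (j₁ : ℕ),
      (∀ (Q : ((metabelianLeafStar p).galoisLevelData h36).PointSeq h36.isCountable (leafStarCentre p))
        (g : FreeProPRankTwo.Grp p), Φ (Q.decompHom g) = FreeProPRankTwo.linChar p e c₁ c₂ g) ∧
      (∀ (m : ℕ) (Q : ((metabelianLeafStar p).galoisLevelData h36).PointSeq h36.isCountable (leafStarLeaf p m))
        (x : Iw.Leaf (p := p) m), Φ (Q.decompHom x) = Iw.logChar m e (c₁ + c₂ * (p : ZMod (p ^ e)) ^ m) x) ∧
      ∀ j, j₁ ≤ j → ∀ g, ((metabelianLeafStar p).galoisLevelData h36).proj h36.isCountable j g = 1 → Φ g = 1 := by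
  haveI : NeZero p := ⟨hp.out.ne_zero⟩
  let χEdge : ∀ m : ℕ, Multiplicative ℤ_[p] →ₜ* Multiplicative (ZMod (p ^ e)) := fun m =>
    (Iw.logChar m e (c₁ + c₂ * (p : ZMod (p ^ e)) ^ m)).comp (Iw.lowHom m)
  have hχEdge : ∀ (m : ℕ) (t : Multiplicative ℤ_[p]),
      χEdge m t = ofAdd ((c₁ + c₂ * (p : ZMod (p ^ e)) ^ m) * PadicInt.toZModPow e t.toAdd) := fun m t => by
    change Iw.logChar m e _ (Iw.lowHom m t) = _
    rw [Iw.logChar_lowHom]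
  let χV : ∀ v : (metabelianLeafStar p).graph.Vertex,
      (metabelianLeafStar p).Gv v →ₜ* Multiplicative (ZMod (p ^ e)) := fun v =>
    match v with
    | none => FreeProPRankTwo.linChar p e c₁ c₂
    | some m => Iw.logChar m e (c₁ + c₂ * (p : ZMod (p ^ e)) ^ m)
  let χE : ∀ x : (metabelianLeafStar p).graph.Edge,
      (metabelianLeafStar p).Ge x →ₜ* Multiplicative (ZMod (p ^ e)) := fun m => χEdge m
  have hχ : ∀ (b : (metabelianLeafStar p).graph.Branch) (v : (metabelianLeafStar p).graph.Vertex)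
      (h : (metabelianLeafStar p).graph.abuts b = some v)
      (t : (metabelianLeafStar p).Ge ((metabelianLeafStar p).graph.edgeOf b)),
      χV v ((metabelianLeafStar p).brHom b v h t) = χE ((metabelianLeafStar p).graph.edgeOf b) t := by
    rintro ⟨m, c⟩ v h t
    have hv : SemiGraph.leafStarVertexOf (m, c) = v := Option.some.inj h
    subst hv
    cases c
    · change Iw.logChar m e _ (Iw.lowHom m t) = χEdge m t
      rw [Iw.logChar_lowHom, hχEdge]
    · change FreeProPRankTwo.linChar p e c₁ c₂ (FreeProPRankTwo.θα p m t) = χEdge m t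
      rw [FreeProPRankTwo.linChar_θα, hχEdge]
  obtain ⟨Φ, hΦP, -, j₁, hj₁⟩ := exists_character_D h36 χV χE hχ
  exact ⟨Φ, j₁, fun Q g => hΦP (leafStarCentre p) Q g, fun m Q x => hΦP (leafStarLeaf p m) Q x,
    fun j hj g hg => hj₁ g (proj_eq_one_of_le hj g hg)⟩

/-! ### Reading an element through a fixed edge -/

/-- **The exponent of an element at a fixed edge.**  If `d` fixes the edge `ε` of `𝒢_{∞,M}`, lying over the base
edge `n`, then `ε` carries a branch over `(n, true)` at a centre-type vertex `(a·P₀).vertex M`, and the level-`M`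
component of `d` is that of `a ψ₀(f·θα n(k)·f⁻¹) a⁻¹` for some `f ∈ F̂₂⁽ᵖ⁾`, `k ∈ ℤ_p` (abc-iut-L3-t11's
branch-stabiliser dictionary). [cite: MochizukiSemiAnbd2006, Rmk 2.2.1 p.24] -/
theorem exists_proj_eq_conj_θα_of_edgeMap_eq (M : ℕ)
    (d : ((metabelianLeafStar p).galoisLevelData h36).temperedPi h36.isCountable)
    (ε : (((metabelianLeafStar p).galoisLevelData h36).tree M).Edge)
    (hε : (((metabelianLeafStar p).galoisLevelData h36).treeAct h36.isCountable M d).hom.edgeMap ε = ε) :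
    ∃ (a : ((metabelianLeafStar p).galoisLevelData h36).temperedPi h36.isCountable) (f : FreeProPRankTwo.Grp p)
      (k : Multiplicative ℤ_[p]),
      ((metabelianLeafStar p).galoisLevelData h36).proj h36.isCountable M d =
        ((metabelianLeafStar p).galoisLevelData h36).proj h36.isCountable M
          (a * psi0 P₀ (f * FreeProPRankTwo.θα p ((((metabelianLeafStar p).galoisLevelData h36).treeProj M).edgeMap ε) k
            * f⁻¹) * a⁻¹) := by
  let Dg := (metabelianLeafStar p).galoisLevelData h36
  set n := (Dg.treeProj M).edgeMap ε with hn
  -- the branch of `ε` over `(n, true)` abuts to a centre-type vertex `(a · P₀).vertex M`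
  obtain ⟨β, hβε, hβb⟩ := SemiGraph.Hom.exists_branchMap_eq (Dg.treeProj M) ε ((n, true) : ℕ × Bool) rfl
  obtain ⟨z, hz⟩ := Dg.exists_tree_abuts_eq_some M β (w := leafStarCentre p) (by rw [hβb]; rfl)
  have hzc : (Dg.treeProj M).vertexMap z = leafStarCentre p := by
    have h := (Dg.treeProj M).abuts_branchMap β z hz
    rw [hβb] at h
    change some (leafStarCentre p) = some _ at h
    exact (Option.some.inj h).symm
  obtain ⟨a, ha⟩ := P₀.exists_smul_vertex_eq M z hzc
  obtain ⟨f, k, h⟩ := (P₀.smul a).exists_proj_eq_proj_decompHom_conj_brHom M d ((n, true) : ℕ × Bool)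
    (leafStar_abuts_true' p n) β hβb (by rw [ha]; exact hz) (by rw [hβε]; exact hε)
  rw [GaloisLevelData.PointSeq.decompHom_smul] at h
  exact ⟨a, f, k, h⟩

/-- **The value of a linear character on an element fixing an edge over `n` is `(c₁ + c₂ pⁿ)·k`** for the
exponent `k` of the dictionary, provided the character kills `ker ρ_M`. [cite: MochizukiSemiAnbd2006, Rmk 2.2.1 p.24] -/
theorem linCharacter_eq_of_proj_eq_conj_θα {e : ℕ} {c₁ c₂ : ZMod (p ^ e)}
    (Φ : ((metabelianLeafStar p).galoisLevelData h36).temperedPi h36.isCountable →* Multiplicative (ZMod (p ^ e)))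
    (hΦP : ∀ (Q : ((metabelianLeafStar p).galoisLevelData h36).PointSeq h36.isCountable (leafStarCentre p))
      (g : FreeProPRankTwo.Grp p), Φ (Q.decompHom g) = FreeProPRankTwo.linChar p e c₁ c₂ g)
    {M : ℕ} (hker : ∀ g, ((metabelianLeafStar p).galoisLevelData h36).proj h36.isCountable M g = 1 → Φ g = 1)
    {d a : ((metabelianLeafStar p).galoisLevelData h36).temperedPi h36.isCountable} {f : FreeProPRankTwo.Grp p}
    {n : ℕ} {k : Multiplicative ℤ_[p]}
    (h : ((metabelianLeafStar p).galoisLevelData h36).proj h36.isCountable M d =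
      ((metabelianLeafStar p).galoisLevelData h36).proj h36.isCountable M
        (a * psi0 P₀ (f * FreeProPRankTwo.θα p n k * f⁻¹) * a⁻¹)) :
    Φ d = ofAdd ((c₁ + c₂ * (p : ZMod (p ^ e)) ^ n) * PadicInt.toZModPow e k.toAdd) := by
  have h1 : Φ (d * (a * psi0 P₀ (f * FreeProPRankTwo.θα p n k * f⁻¹) * a⁻¹)⁻¹) = 1 :=
    hker _ (by rw [map_mul, map_inv, h, mul_inv_cancel])
  rw [map_mul, map_inv, mul_inv_eq_one] at h1
  rw [h1, map_mul, map_mul, map_inv, mul_inv_cancel_comm, linCharacter_psi0_conj_θα P₀ Φ hΦP n f k]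

/-! ### The `a`-character sees every non-trivial element fixing edges at all deep levels -/

include P₀ in
/-- **If the `a`-character modulo `p^e`, `e ≥ N_j`, kills an element fixing an edge at a level `M ≥ j, j₁`, then
its level-`j` component is trivial**: the exponent `k` of `d` at the fixed edge is a `p^e`-th power, and
`ψ₀((f·θα(k')·f⁻¹)^{p^e})` dies at level `j` (`gal_P₀_pow`). [cite: MochizukiSemiAnbd2006, Thm 3.7(iv) p.41] -/
theorem proj_eq_one_of_aCharacter_eq_one {e : ℕ}
    (Φ : ((metabelianLeafStar p).galoisLevelData h36).temperedPi h36.isCountable →* Multiplicative (ZMod (p ^ e)))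
    (hΦP : ∀ (Q : ((metabelianLeafStar p).galoisLevelData h36).PointSeq h36.isCountable (leafStarCentre p))
      (g : FreeProPRankTwo.Grp p), Φ (Q.decompHom g) = FreeProPRankTwo.linChar p e 1 0 g)
    {j M : ℕ} (hjM : j ≤ M) (he : lvl h36 j ≤ e)
    (hker : ∀ g, ((metabelianLeafStar p).galoisLevelData h36).proj h36.isCountable M g = 1 → Φ g = 1)
    (d : ((metabelianLeafStar p).galoisLevelData h36).temperedPi h36.isCountable)
    (ε : (((metabelianLeafStar p).galoisLevelData h36).tree M).Edge)
    (hε : (((metabelianLeafStar p).galoisLevelData h36).treeAct h36.isCountable M d).hom.edgeMap ε = ε)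
    (hΦd : Φ d = 1) :
    ((metabelianLeafStar p).galoisLevelData h36).proj h36.isCountable j d = 1 := by
  haveI : NeZero p := ⟨hp.out.ne_zero⟩
  let Dg := (metabelianLeafStar p).galoisLevelData h36
  obtain ⟨a, f, k, h⟩ := exists_proj_eq_conj_θα_of_edgeMap_eq P₀ M d ε hε
  set n := (Dg.treeProj M).edgeMap ε with hn
  have hval := linCharacter_eq_of_proj_eq_conj_θα P₀ Φ hΦP hker h
  rw [hΦd, zero_mul, add_zero, one_mul] at hval
  -- `k` is divisible by `p^e`
  have hk0 : PadicInt.toZModPow e k.toAdd = 0 := ofAdd_eq_one.mp hval.symm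
  obtain ⟨x, hx⟩ : ∃ x : ℤ_[p], k.toAdd = (p : ℤ_[p]) ^ e * x := by
    have hmem : k.toAdd ∈ RingHom.ker (PadicInt.toZModPow e) := hk0
    rw [PadicInt.ker_toZModPow, Ideal.mem_span_singleton] at hmem
    exact hmem
  have hk : k = ofAdd x ^ p ^ e := by
    rw [← ofAdd_nsmul, nsmul_eq_mul, Nat.cast_pow, ← hx, ofAdd_toAdd]
  -- hence `ψ₀(f θα(k) f⁻¹)` dies at level `j`
  have hpow : f * FreeProPRankTwo.θα p n k * f⁻¹ = (f * FreeProPRankTwo.θα p n (ofAdd x) * f⁻¹) ^ p ^ e := by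
    rw [hk, map_pow, conj_pow]
  have hgal : Dg.proj h36.isCountable j (psi0 P₀ (f * FreeProPRankTwo.θα p n k * f⁻¹)) = 1 := by
    rw [proj_psi0, hpow]
    exact gal_P₀_pow P₀ _ j e he
  -- read `ρ_j(d)` through `ρ_M(d)`
  have h2 : Dg.proj h36.isCountable j d =
      Dg.proj h36.isCountable j (a * psi0 P₀ (f * FreeProPRankTwo.θα p n k * f⁻¹) * a⁻¹) := by
    rw [← Dg.mapLE_proj h36.isCountable hjM d, h, Dg.mapLE_proj]
  rw [h2, map_mul, map_mul, hgal, mul_one, map_inv, mul_inv_cancel]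

include P₀ in
/-- **A non-trivial element fixing a tree edge at every level from some level on is SEEN by an `a`-character**:
there are a modulus `p^{e₀}` and the torsor character `Φ` of the linear system `(e₀; 1, 0)` — with its centre
values, leaf values and level kernel — such that `Φ(d) ≠ 1`. [cite: MochizukiSemiAnbd2006, Thm 3.7(iv) p.41] -/
theorem exists_aCharacter_ne_one_of_fixes_edges
    (d : ((metabelianLeafStar p).galoisLevelData h36).temperedPi h36.isCountable) (hd1 : d ≠ 1) (i₀ : ℕ)
    (hfix : ∀ M, i₀ ≤ M → ∃ ε : (((metabelianLeafStar p).galoisLevelData h36).tree M).Edge,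
      (((metabelianLeafStar p).galoisLevelData h36).treeAct h36.isCountable M d).hom.edgeMap ε = ε) :
    ∃ (e₀ : ℕ)
      (Φ : ((metabelianLeafStar p).galoisLevelData h36).temperedPi h36.isCountable →* Multiplicative (ZMod (p ^ e₀)))
      (j₁ : ℕ),
      (∀ (Q : ((metabelianLeafStar p).galoisLevelData h36).PointSeq h36.isCountable (leafStarCentre p))
        (g : FreeProPRankTwo.Grp p), Φ (Q.decompHom g) = FreeProPRankTwo.linChar p e₀ 1 0 g) ∧
      (∀ (m : ℕ) (Q : ((metabelianLeafStar p).galoisLevelData h36).PointSeq h36.isCountable (leafStarLeaf p m))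
        (x : Iw.Leaf (p := p) m), Φ (Q.decompHom x) = Iw.logChar m e₀ (1 + 0 * (p : ZMod (p ^ e₀)) ^ m) x) ∧
      (∀ j, j₁ ≤ j → ∀ g, ((metabelianLeafStar p).galoisLevelData h36).proj h36.isCountable j g = 1 → Φ g = 1) ∧
      Φ d ≠ 1 := by
  by_contra hcon
  push Not at hcon
  apply hd1
  refine ((metabelianLeafStar p).galoisLevelData h36).pi_ext h36.isCountable fun j => ?_
  rw [map_one]
  obtain ⟨Φ, j₁, hΦP, hΦL, hker⟩ := exists_linCharacter₂ h36 (lvl h36 j) (1 : ZMod (p ^ lvl h36 j)) 0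
  have hΦd : Φ d = 1 := hcon (lvl h36 j) Φ j₁ hΦP hΦL hker
  let M := max (max j j₁) i₀
  obtain ⟨ε, hε⟩ := hfix M (le_max_right _ _)
  exact proj_eq_one_of_aCharacter_eq_one P₀ Φ hΦP ((le_max_left j j₁).trans (le_max_left _ _)) le_rfl
    (hker M ((le_max_right j j₁).trans (le_max_left _ _))) d ε hε hΦd

/-! ### GOOD base edges: the twisted character `(pⁿ, −1)` sees `d` ⇒ no fixed edge over `n` -/

include P₀ in
/-- **If the twisted character `Φ_{(pⁿ,−1)}` modulo some `p^e` sees `d`, then from its level `j₁` on `d` fixes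
NO edge of `𝒢_{∞,M}` over the base edge `n`**: the character kills `ker ρ_M` and every conjugate of the branch
image `⟨a·b^{pⁿ}⟩‾` (`(pⁿ − pⁿ)·k = 0`), so gen 6's `edgeMap_edgeOf_ne_of_ne_one` applies at the centre-type end
of such an edge. [cite: MochizukiSemiAnbd2006, Thm 3.7(iv) p.41] -/
theorem forall_edgeMap_ne_of_twistCharacter_ne_one (n : ℕ) {e : ℕ}
    (Φ : ((metabelianLeafStar p).galoisLevelData h36).temperedPi h36.isCountable →* Multiplicative (ZMod (p ^ e)))
    {j₁ : ℕ}
    (hΦP : ∀ (Q : ((metabelianLeafStar p).galoisLevelData h36).PointSeq h36.isCountable (leafStarCentre p))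
      (g : FreeProPRankTwo.Grp p), Φ (Q.decompHom g) =
        FreeProPRankTwo.linChar p e ((p : ZMod (p ^ e)) ^ n) (-1) g)
    (hker : ∀ j, j₁ ≤ j → ∀ g, ((metabelianLeafStar p).galoisLevelData h36).proj h36.isCountable j g = 1 → Φ g = 1)
    (d : ((metabelianLeafStar p).galoisLevelData h36).temperedPi h36.isCountable) (hΦd : Φ d ≠ 1)
    (M : ℕ) (hM : j₁ ≤ M) (ε : (((metabelianLeafStar p).galoisLevelData h36).tree M).Edge)
    (hεn : (((metabelianLeafStar p).galoisLevelData h36).treeProj M).edgeMap ε = n) :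
    (((metabelianLeafStar p).galoisLevelData h36).treeAct h36.isCountable M d).hom.edgeMap ε ≠ ε := by
  intro hε
  let Dg := (metabelianLeafStar p).galoisLevelData h36
  obtain ⟨β, hβε, hβb⟩ := SemiGraph.Hom.exists_branchMap_eq (Dg.treeProj M) ε ((n, true) : ℕ × Bool)
    (by rw [hεn]; rfl)
  obtain ⟨z, hz⟩ := Dg.exists_tree_abuts_eq_some M β (w := leafStarCentre p) (by rw [hβb]; rfl)
  have hzc : (Dg.treeProj M).vertexMap z = leafStarCentre p := by
    have h := (Dg.treeProj M).abuts_branchMap β z hz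
    rw [hβb] at h
    change some (leafStarCentre p) = some _ at h
    exact (Option.some.inj h).symm
  obtain ⟨a, ha⟩ := P₀.exists_smul_vertex_eq M z hzc
  have hbr : ∀ (f : FreeProPRankTwo.Grp p) (k : Multiplicative ℤ_[p]),
      Φ (psi0 P₀ (f * FreeProPRankTwo.θα p n k * f⁻¹)) = 1 := by
    intro f k
    rw [linCharacter_psi0_conj_θα P₀ Φ hΦP n f k, neg_one_mul, add_neg_cancel, zero_mul, ofAdd_zero]
  exact edgeMap_edgeOf_ne_of_ne_one P₀ Φ M n (hker M hM) hbr d hΦd a β hβb (by rw [ha]; exact hz)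
    (by rw [hβε]; exact hε)

/-! ### The BAD base edge: the twisted character kills `d` ⇒ every fixed edge lies over `n` -/

/-- Integer arithmetic of the bad edge: for `m ≠ n`, `p^{n+e+1} ∣ (pⁿ − pᵐ)·t ⇒ p^{e+1} ∣ t`.
[cite: MochizukiSemiAnbd2006, Thm 3.7(iv) p.41] -/
theorem dvd_of_dvd_sub_pow_mul {n m e : ℕ} (hmn : m ≠ n) {t : ℤ}
    (h : ((p : ℤ) ^ (n + e + 1)) ∣ ((p : ℤ) ^ n - (p : ℤ) ^ m) * t) : (p : ℤ) ^ (e + 1) ∣ t := by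
  have hp0 : (p : ℤ) ≠ 0 := by exact_mod_cast hp.out.ne_zero
  -- `1 - p^k` is prime to `p` for `k ≥ 1`
  have hcop : ∀ k : ℕ, 1 ≤ k → ∀ N : ℕ, IsCoprime ((p : ℤ) ^ N) (1 - (p : ℤ) ^ k) := by
    intro k hk N
    apply IsCoprime.pow_left
    refine ⟨(p : ℤ) ^ (k - 1), 1, ?_⟩
    rw [one_mul, ← pow_succ, Nat.sub_add_cancel hk, add_sub_cancel]
  rcases Nat.lt_or_gt_of_ne hmn with hlt | hgt
  · -- `m < n`: `pⁿ − pᵐ = -pᵐ (1 - p^{n-m})`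
    have hfac : (p : ℤ) ^ n - (p : ℤ) ^ m = -((p : ℤ) ^ m * (1 - (p : ℤ) ^ (n - m))) := by
      rw [mul_sub, mul_one, ← pow_add, Nat.add_sub_cancel' hlt.le]; ring
    rw [hfac, neg_mul, dvd_neg, mul_assoc, show n + e + 1 = m + (n - m + e + 1) by omega, pow_add] at h
    have h1 : (p : ℤ) ^ (n - m + e + 1) ∣ (1 - (p : ℤ) ^ (n - m)) * t :=
      (mul_dvd_mul_iff_left (pow_ne_zero _ hp0)).mp h
    have h2 : (p : ℤ) ^ (n - m + e + 1) ∣ t := (hcop (n - m) (by omega) _).dvd_of_dvd_mul_left h1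
    exact (pow_dvd_pow (p : ℤ) (by omega : e + 1 ≤ n - m + e + 1)).trans h2
  · -- `n < m`: `pⁿ − pᵐ = pⁿ (1 - p^{m-n})`
    have hfac : (p : ℤ) ^ n - (p : ℤ) ^ m = (p : ℤ) ^ n * (1 - (p : ℤ) ^ (m - n)) := by
      rw [mul_sub, mul_one, ← pow_add, Nat.add_sub_cancel' hgt.le]
    rw [hfac, mul_assoc, show n + e + 1 = n + (e + 1) by omega, pow_add] at h
    have h1 : (p : ℤ) ^ (e + 1) ∣ (1 - (p : ℤ) ^ (m - n)) * t := (mul_dvd_mul_iff_left (pow_ne_zero _ hp0)).mp h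
    exact (hcop (m - n) (by omega) _).dvd_of_dvd_mul_left h1

include P₀ in
/-- **BAD base edge ⇒ PURE TYPE.**  If the `a`-character modulo `p^{e₀}` sees `d` (`Φ₀ d ≠ 1`) while the
twisted character `(pⁿ, −1)` modulo `p^{n+e₀+1}` kills `d` (`Φₙ d = 1`), then from the common level of the two
characters on EVERY tree edge fixed by `d` lies over the base edge `n`: at a fixed edge over `m` the exponent `k`
has `p^{e₀} ∤ k` but `p^{n+e₀+1} ∣ (pⁿ − pᵐ)·k`, forcing `m = n`. [cite: MochizukiSemiAnbd2006, Thm 3.7(iv) p.41] -/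
theorem treeProj_edgeMap_eq_of_twistCharacter_eq_one (n : ℕ) {e₀ : ℕ}
    (Φ₀ : ((metabelianLeafStar p).galoisLevelData h36).temperedPi h36.isCountable →* Multiplicative (ZMod (p ^ e₀)))
    (hΦ₀P : ∀ (Q : ((metabelianLeafStar p).galoisLevelData h36).PointSeq h36.isCountable (leafStarCentre p))
      (g : FreeProPRankTwo.Grp p), Φ₀ (Q.decompHom g) = FreeProPRankTwo.linChar p e₀ 1 0 g)
    (Φₙ : ((metabelianLeafStar p).galoisLevelData h36).temperedPi h36.isCountable →*
      Multiplicative (ZMod (p ^ (n + e₀ + 1))))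
    (hΦₙP : ∀ (Q : ((metabelianLeafStar p).galoisLevelData h36).PointSeq h36.isCountable (leafStarCentre p))
      (g : FreeProPRankTwo.Grp p), Φₙ (Q.decompHom g) =
        FreeProPRankTwo.linChar p (n + e₀ + 1) ((p : ZMod (p ^ (n + e₀ + 1))) ^ n) (-1) g)
    {M : ℕ} (hker₀ : ∀ g, ((metabelianLeafStar p).galoisLevelData h36).proj h36.isCountable M g = 1 → Φ₀ g = 1)
    (hkerₙ : ∀ g, ((metabelianLeafStar p).galoisLevelData h36).proj h36.isCountable M g = 1 → Φₙ g = 1)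
    (d : ((metabelianLeafStar p).galoisLevelData h36).temperedPi h36.isCountable) (hΦ₀d : Φ₀ d ≠ 1)
    (hΦₙd : Φₙ d = 1) (ε : (((metabelianLeafStar p).galoisLevelData h36).tree M).Edge)
    (hε : (((metabelianLeafStar p).galoisLevelData h36).treeAct h36.isCountable M d).hom.edgeMap ε = ε) :
    (((metabelianLeafStar p).galoisLevelData h36).treeProj M).edgeMap ε = n := by
  haveI : NeZero p := ⟨hp.out.ne_zero⟩
  let Dg := (metabelianLeafStar p).galoisLevelData h36
  obtain ⟨a, f, k, h⟩ := exists_proj_eq_conj_θα_of_edgeMap_eq P₀ M d ε hε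
  set m : ℕ := (Dg.treeProj M).edgeMap ε with hm
  by_contra hmn
  have h0 := linCharacter_eq_of_proj_eq_conj_θα P₀ Φ₀ hΦ₀P hker₀ h
  have hN := linCharacter_eq_of_proj_eq_conj_θα P₀ Φₙ hΦₙP hkerₙ h
  rw [zero_mul, add_zero, one_mul] at h0
  rw [hΦₙd, neg_one_mul] at hN
  -- the exponent modulo `p^{n+e₀+1}` and modulo `p^{e₀}`
  set E := n + e₀ + 1 with hE
  set x : ZMod (p ^ E) := PadicInt.toZModPow E k.toAdd with hx
  have hxE : ((p : ZMod (p ^ E)) ^ n - (p : ZMod (p ^ E)) ^ m) * x = 0 := by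
    rw [sub_eq_add_neg]; exact (ofAdd_eq_one.mp hN.symm)
  have hx0 : PadicInt.toZModPow e₀ k.toAdd ≠ 0 := fun h0' => hΦ₀d (by rw [h0, h0', ofAdd_zero])
  -- compatibility of the two reductions
  have hdvd : p ^ e₀ ∣ p ^ E := pow_dvd_pow p (by omega)
  have hcast : (ZMod.castHom hdvd (ZMod (p ^ e₀))) x = PadicInt.toZModPow e₀ k.toAdd := by
    rw [hx, ← RingHom.comp_apply, PadicInt.zmod_cast_comp_toZModPow e₀ E (by omega)]
  -- lift to `ℤ`: `p^E ∣ (pⁿ − pᵐ)·x.val`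
  have hint : ((p : ℤ) ^ E) ∣ ((p : ℤ) ^ n - (p : ℤ) ^ m) * (x.val : ℤ) := by
    have h1 : ((((p : ℤ) ^ n - (p : ℤ) ^ m) * (x.val : ℤ) : ℤ) : ZMod (p ^ E)) = 0 := by
      push_cast
      rw [ZMod.natCast_zmod_val]
      exact hxE
    have h2 := (ZMod.intCast_zmod_eq_zero_iff_dvd _ (p ^ E)).mp h1
    push_cast at h2
    exact h2
  have hdiv : (p : ℤ) ^ (e₀ + 1) ∣ (x.val : ℤ) := dvd_of_dvd_sub_pow_mul (p := p) hmn (e := e₀) hint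
  have hdiv' : (p ^ e₀ : ℕ) ∣ x.val := by
    have h3 : (p : ℤ) ^ e₀ ∣ (x.val : ℤ) := (pow_dvd_pow (p : ℤ) (Nat.le_succ e₀)).trans hdiv
    exact_mod_cast h3
  apply hx0
  rw [← hcast, ZMod.castHom_apply, ZMod.cast_eq_val, (ZMod.natCast_eq_zero_iff _ _).mpr hdiv']

end ProfiniteSemiGraph

end Literature.AnabelianGeometry.SemiGraphs

end
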